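import Literature.AnabelianGeometry.AbsoluteAnabelian.AbsTopIII.ReconstructionThm19Functorial
import Literature.IUT.HodgeTheaters.InitialThetaDataCurveModelLocal
import Literature.IUT.HodgeTheaters.InitialThetaDataAbsoluteGaloisMoves
import HarnessLib

/-!
# [IUTchI] Ex. 5.1 (i) / Ex. 5.4 (iv): the strengthened [AbsTopIII] Thm. 1.9 binder AT THE NAMED PAIR — `D.Thm19' G`

S. Mochizuki, *Inter-universal Teichmüller theory I*, kurims manuscript (May 2020), Example 5.1 (i) pp. 123–124
(«by applying [AbsTopIII] Theorem 1.9, via the Θ-approach … we may construct group-theoretically from `π₁(†𝒟^⊛)`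
isomorphs `π₁^{rat}(†𝒟^⊛) ↷ 𝕄^⊛_∞κ(†𝒟^⊚)`»), Example 5.4 (iv) p. 149 ([IUTchI] Ex 5.1 (i) p.123, Ex 5.4 (iv)
p.149) [claim: Mochizuki2012, status: disputed] (D-0012 claim key; series status DISPUTED — nothing of the series is
asserted here); S. Mochizuki, *Topics in Absolute Anabelian Geometry III*, J. Math. Sci. Univ. Tokyo **22** (2015),
Thm. 1.9 pp. 37–38 (journal pp. 986–988) [cite: MochizukiAbsTopIII2015, Thm 1.9 pp.37-38].

abc-iut cell, GAP B later tranche row GB-17 (IUT-side half; RULINGS #352/#354 (iii)/#357; design memo of record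
`pub/ideators/abc-iut-inv-2/X143-CURE-DESIGN.md` v0.3 sha16 abfa469e185ddc38 §(ii)/(iii); seat abc-iut-c312-2
gen 13 = L4 lineage / X-143 owner by ruling).  The GENERIC strengthened fact `AbsTopIII.Thm_1_9' M ρ` and its
non-transparency lemmas live in `AbsTopIII/ReconstructionThm19Functorial.lean` ([AbsTopIII] must not import
[IUTchI]); THIS file instantiates them at the NAMED PAIR of the GAP B C2 lane:

* `InitialThetaData.nfGaloisAction G` — the recorded action of the ENRICHED model `D.nfCurveModelLocal G`
  (GB-13): ONE recorded curve, `C_F` (`D.globalCurve G .CF`, whose extension is `D.geom.extF = (Π_{C_F} ↠ G_F)`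
  and whose `K_{Z_NF}` is `RatFunc Fbar = F̄(t)`, both by `rfl`), acted on by `g ∈ Π_{C_F}` through the
  COEFFICIENTS, `f ↦ f^{augGF g}` (`ratFuncMapCoeffs (D.augGF g)`) — literally the right-hand side of GB-14's
  `ReconEquivariantFor` (★ `FrobenioidBridgeEx54ivInfKappaRecon`);
* `InitialThetaData.Thm19' G := Thm_1_9' (D.nfCurveModelLocal G) (D.nfGaloisAction G)` — THE BINDER OF RECORD
  `(h₁₉' : D.Thm19' G)` of the later tranche (GB-19/GB-21), instance form ONLY; `Thm19'.toThm_1_9`;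
* `InitialThetaData.not_witnessedBy_thm19'_of_isInnerTrivialAt` — THE KERNEL FORM OF ERRATA-L5 X-143 at the named
  pair (GB-17 acceptance (b), RULINGS #352/#354 (ii)): an algorithm that is inner-trivial on `Π_{C_F} ↠ G_F`
  («`map := id`», answer read off the model) does NOT witness `Thm19' G`, as soon as `Gal(F̄/F)` moves one constant
  (`hcoeff`) — PROVED (`augGF` is onto, `ratFuncMapCoeffs_C`, `RatFunc.C_injective`); and its BINDER-FREE form
  `not_witnessedBy_thm19'_of_isInnerTrivialAt'` with `hcoeff` DISCHARGED BY NAME by GB-07's rider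
  `D.exists_galois_apply_ne` (★ `InitialThetaDataAbsoluteGaloisMoves`; chair's optional rider, RULINGS #360 (A)) — so
  `hcoeff` is no longer a residual anybody carries.

HONEST FRAMING: `Thm19' G` is a HYPOTHESIS (a strengthened FACT typed by name), not [AbsTopIII] Thm 1.9 proved; the
NEG lemma is about OUR witness class at OUR typed objects; non-transparency is relative to the recorded action (here
the coefficient action, which moves every `c ∈ F̄ ∖ F`) and concerns the Galois action on CONSTANTS — the
transcendental generator of `F̄(t)` stays comparison-only (L4 note of record, `ReconstructionThm19Functorial` module
docstring); no L4/L5 ★ file is edited; no `instance`, no notation, no axiom, no `sorry`; no side is taken on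
[IUTchIII] Cor. 3.12; count-neutral; nothing here asserts that abc is proved or refuted.
-/

noncomputable section

universe u

namespace Literature.IUT.HodgeTheaters

open Literature.AnabelianGeometry.AbsoluteAnabelian
open Literature.AnabelianGeometry.AbsoluteAnabelian.AbsTopIII
open Literature.FieldTheory.FunctionField

namespace InitialThetaData

variable {F K Fbar : Type u} [Field F] [NumberField F] [Field K] [NumberField K] [Algebra F K]
  [Field Fbar] [Algebra F Fbar] [Algebra K Fbar] {E : WeierstrassCurve F} [E.IsElliptic] {l : ℕ}
  {Pb : BadPlacePredicates K} (D : InitialThetaData F K Fbar E l Pb)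

/-- **The recorded action of the enriched model at `C_F`** (memo §(iii)): ONE recorded curve `C_F = D.globalCurve G
.CF` (extension `D.geom.extF`, `K_{Z_NF} = RatFunc Fbar`, both `rfl`), `g ∈ Π_{C_F}` acting through the
coefficients by `augGF g ∈ Gal(F̄/F)` — the right-hand side of GB-14's `ReconEquivariantFor`.  (More recorded
curves — `C_K`; `X_F`, `X_K`; the local `C`-curves of memo §(iv) (v-loc) — extend the DATUM, not the binder's
admissibility.) ([IUTchI] Ex 5.1 (i) p.123) [claim: Mochizuki2012, status: disputed] -/
def nfGaloisAction (G : D.LocalThetaGeometry) : (D.nfCurveModelLocal G).NFGaloisAction where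
  ι := PUnit
  curve _ := D.globalCurve G .CF
  act _ g := ratFuncMapCoeffs (D.augGF g : Fbar →+* Fbar)

/-- `rfl` read-out: the recorded curve is `C_F`. ([IUTchI] Ex 5.1 (i) p.123) [claim: Mochizuki2012, status: disputed] -/
@[simp] theorem nfGaloisAction_curve (G : D.LocalThetaGeometry) (i : (D.nfGaloisAction G).ι) :
    (D.nfGaloisAction G).curve i = D.globalCurve G .CF := rfl

/-- `rfl` read-out: the recorded action is the coefficient action through `augGF`.
([IUTchI] Ex 5.1 (i) p.123) [claim: Mochizuki2012, status: disputed] -/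
theorem nfGaloisAction_act (G : D.LocalThetaGeometry) (i : (D.nfGaloisAction G).ι) (g : D.geom.extF.arith) :
    (D.nfGaloisAction G).act i g = ratFuncMapCoeffs (D.augGF g : Fbar →+* Fbar) := rfl

/-- **THE BINDER OF RECORD of the later tranche** (memo §(iii); RULINGS #354 (iii)): `(h₁₉' : D.Thm19' G)` =
`AbsTopIII.Thm_1_9'` at the named pair (enriched model, coefficient action at `C_F`) — BY NAME, instance form ONLY;
never `∀ M ρ, Thm_1_9' M ρ` (refuted a fortiori by `not_forall_thm_1_9`).  A HYPOTHESIS; asserted by nobody.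
([IUTchI] Ex 5.1 (i) p.123) [claim: Mochizuki2012, status: disputed] -/
abbrev Thm19' (G : D.LocalThetaGeometry) : Prop := Thm_1_9' (D.nfCurveModelLocal G) (D.nfGaloisAction G)

/-- `h₁₉' → h₁₉` at the enriched model: the old residual record (`C2Residuals.h₁₉`, `C2Residuals'.h₁₉`) stays
derivable from the new binder. ([IUTchI] Ex 5.1 (i) p.123) [claim: Mochizuki2012, status: disputed] -/
theorem Thm19'.toThm_1_9 {G : D.LocalThetaGeometry} (h : D.Thm19' G) : Thm_1_9 (D.nfCurveModelLocal G) :=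
  Thm_1_9'.toThm_1_9 h

/-- The optional stronger binder `D.Thm19c' G` (constants conjunct, memo §(i) (i-d)); nobody is required to take it.
([IUTchI] Ex 5.1 (i) p.123) [claim: Mochizuki2012, status: disputed] -/
abbrev Thm19c' (G : D.LocalThetaGeometry) : Prop := Thm_1_9c' (D.nfCurveModelLocal G) (D.nfGaloisAction G)

/-- `D.Thm19c' G → D.Thm19' G`. ([IUTchI] Ex 5.1 (i) p.123) [claim: Mochizuki2012, status: disputed] -/
theorem Thm19c'.toThm19' {G : D.LocalThetaGeometry} (h : D.Thm19c' G) : D.Thm19' G :=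
  Thm_1_9c'.toThm_1_9' h

/-- **The recorded action MOVES something** (the `hmove` of the generic NEG lemma, at the named pair): as soon as
`Gal(F̄/F)` moves one constant `c`, some `g ∈ Π_{C_F}` moves `C c ∈ F̄(t)` (`augGF` is onto).
([IUTchI] Ex 5.1 (i) p.123) [claim: Mochizuki2012, status: disputed] -/
theorem nfGaloisAction_exists_act_ne (G : D.LocalThetaGeometry)
    (hcoeff : ∃ (σ : Fbar ≃ₐ[F] Fbar) (c : Fbar), σ c ≠ c) (i : (D.nfGaloisAction G).ι) :
    ∃ (g : ((D.nfCurveModelLocal G).ext ((D.nfGaloisAction G).curve i)).arith)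
      (f : (D.nfCurveModelLocal G).NFFunctionField ((D.nfGaloisAction G).curve i)),
      (D.nfGaloisAction G).act i g f ≠ f := by
  obtain ⟨σ, c, hc⟩ := hcoeff
  obtain ⟨g, rfl⟩ := D.augGF_surjective σ
  refine ⟨g, RatFunc.C c, ?_⟩
  change ratFuncMapCoeffs (D.augGF g : Fbar →+* Fbar) (RatFunc.C c) ≠ RatFunc.C c
  rw [ratFuncMapCoeffs_C]
  exact fun h => hc (RatFunc.C_injective h)

/-- **KERNEL FORM OF ERRATA-L5 X-143 AT THE NAMED PAIR (GB-17's NEG lemma)**: an algorithm that is INNER-TRIVIAL on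
`Π_{C_F} ↠ G_F` («`map := id`»: the answer read off the model — such algorithms DO witness `Thm_1_9` as typed) does
NOT witness `D.Thm19' G`, as soon as `Gal(F̄/F)` moves one constant of `F̄`.  PROVED; a statement about OUR witness
class, not «¬ Thm19' G». ([IUTchI] Ex 5.1 (i) p.123) [claim: Mochizuki2012, status: disputed] -/
theorem not_witnessedBy_thm19'_of_isInnerTrivialAt (G : D.LocalThetaGeometry) {A : NFPortionAlgorithm.{u}}
    (hA : A.IsInnerTrivialAt D.geom.extF) (hcoeff : ∃ (σ : Fbar ≃ₐ[F] Fbar) (c : Fbar), σ c ≠ c) :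
    ¬ Thm_1_9'.WitnessedBy (D.nfCurveModelLocal G) (D.nfGaloisAction G) A :=
  Thm_1_9'.not_witnessedBy_of_isInnerTrivialAt (ρ := D.nfGaloisAction G) PUnit.unit
    (D.isThm19Input_global G .CF) hA (D.nfGaloisAction_exists_act_ne G hcoeff PUnit.unit)

/-- **Binder-free kernel form of X-143 at the named pair** (chair's optional rider, RULINGS #360 (A)): `hcoeff`
DISCHARGED BY NAME — `Gal(F̄/F)` does move a constant (`D.exists_galois_apply_ne`, GB-07's rider
`InitialThetaDataAbsoluteGaloisMoves`: `F̄ ≠ F` for a number field).  So: NO inner-trivial algorithm witnesses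
`D.Thm19' G`, unconditionally. ([IUTchI] Ex 5.1 (i) p.123) [claim: Mochizuki2012, status: disputed] -/
theorem not_witnessedBy_thm19'_of_isInnerTrivialAt' (G : D.LocalThetaGeometry) {A : NFPortionAlgorithm.{u}}
    (hA : A.IsInnerTrivialAt D.geom.extF) :
    ¬ Thm_1_9'.WitnessedBy (D.nfCurveModelLocal G) (D.nfGaloisAction G) A :=
  D.not_witnessedBy_thm19'_of_isInnerTrivialAt G hA D.exists_galois_apply_ne

/-- The recorded action at `C_F` moves something, unconditionally (the `hmove` of the generic NEG lemma, `hcoeff`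
discharged by name). ([IUTchI] Ex 5.1 (i) p.123) [claim: Mochizuki2012, status: disputed] -/
theorem nfGaloisAction_exists_act_ne' (G : D.LocalThetaGeometry) (i : (D.nfGaloisAction G).ι) :
    ∃ (g : ((D.nfCurveModelLocal G).ext ((D.nfGaloisAction G).curve i)).arith)
      (f : (D.nfCurveModelLocal G).NFFunctionField ((D.nfGaloisAction G).curve i)),
      (D.nfGaloisAction G).act i g f ≠ f :=
  D.nfGaloisAction_exists_act_ne G D.exists_galois_apply_ne i

/-- The same for the optional stronger body: an inner-trivial algorithm does not witness `WitnessedByConst` either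
(a fortiori, via `toWitnessedBy`). ([IUTchI] Ex 5.1 (i) p.123) [claim: Mochizuki2012, status: disputed] -/
theorem not_witnessedByConst_thm19'_of_isInnerTrivialAt (G : D.LocalThetaGeometry) {A : NFPortionAlgorithm.{u}}
    (hA : A.IsInnerTrivialAt D.geom.extF) (hcoeff : ∃ (σ : Fbar ≃ₐ[F] Fbar) (c : Fbar), σ c ≠ c) :
    ¬ Thm_1_9'.WitnessedByConst (D.nfCurveModelLocal G) (D.nfGaloisAction G) A := fun h =>
  D.not_witnessedBy_thm19'_of_isInnerTrivialAt G hA hcoeff h.toWitnessedBy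

/-- **What a witness DOES give at the named pair** (the clause GB-19 consumes): every witness of `D.Thm19' G` is
inner-equivariant at `C_F` for the coefficient action — some comparison `φ : K_A(Π_{C_F}) ≃+* F̄(t)` with
`φ (A.map (innerIso g) x) = (φ x)^{augGF g}` for all `g`, `x`. ([IUTchI] Ex 5.1 (i) p.123)
[claim: Mochizuki2012, status: disputed] -/
theorem Thm19'.exists_innerEquivariant {G : D.LocalThetaGeometry} (h : D.Thm19' G) :
    ∃ A : NFPortionAlgorithm.{u}, Thm_1_9'.WitnessedBy (D.nfCurveModelLocal G) (D.nfGaloisAction G) A ∧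
      ∃ φ : (A.obj D.geom.extF).functionField ≃+* RatFunc Fbar,
        ∀ (g : D.geom.extF.arith) (x : (A.obj D.geom.extF).functionField),
          φ ((A.map (D.geom.extF.innerIso g)).funEquiv x) = ratFuncMapCoeffs (D.augGF g : Fbar →+* Fbar) (φ x) := by
  obtain ⟨A, hA⟩ := h
  exact ⟨A, hA, hA.2 PUnit.unit (D.isThm19Input_global G .CF)⟩

end InitialThetaData

end Literature.IUT.HodgeTheaters

end
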